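import Literature.MathematicalPhysics.QuantumLattice.GrassmannBerezinLaplacianBridge
import Literature.MathematicalPhysics.QuantumFieldTheory.Dimock2011to13.QED3TwoSpeciesKernels
import Literature.MathematicalPhysics.QuantumFieldTheory.Dimock2011to13.QED3UnitGaussianMoments
import HarnessLib

/-!
# The charged Gaussian `dμ_G` of the Berezin ↔ Laplacian bridge IS a `dμ_Γ` of the 3-torus paper's Appendix B:
# `twoSpeciesCov` ↔ `IsChargedCov` ∕ `twoPoint`, and (309)∕(312) for `dμ_G` — the dictionary between the two
# two-species layers of the tree

Topic `Literature/MathematicalPhysics/QuantumFieldTheory/Dimock2011to13`; glue between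
`QuantumLattice/GrassmannBerezinLaplacianBridge.lean` (§4: `twoSpeciesCov R G = [[0, Gᵀ], [−G, 0]]`, the covariance with
`∫ ψᵢψ̄ⱼ dμ_G = Gᵢⱼ` in the convention `ψ̄ = inl`, `ψ = inr` of `GrassmannIntegral.psiBar ∕ psi`; `∫dψ̄dψ e^{ψ̄Aψ}F =
ε det A · ∫F dμ_G` for `A G = −1`) and `QED3TwoSpeciesKernels.lean` (the 3-torus paper I, App. B (305)–(312): `species`,
`IsChargedCov`, `twoPoint C x x̄ = ∫Ψ(x)Ψ̄(x̄)dμ_Γ` in the convention `Ψ = inl`, `Ψ̄ = inr`, the determinant rule (309)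
`gaussExpect_pairedProd` and the expansion (312) `gaussExpect_eq_312`).

statement-level skeleton of published theorems with citation tags; proofs where landed; nothing here is a claim about the Yang–Mills mass gap

**Sources.**  J. Dimock, *Quantum electrodynamics on the 3-torus. I*, arXiv:math-ph/0210020 [Dimock2002QED3TorusI], App. B
(308)–(312) p.63 L35 – p.64 L18 (*"`∫ Ψ(x₁)Ψ̄(x̄₁)⋯Ψ(x_n)Ψ̄(x̄_n) dμ_Γ(Ψ,Ψ̄) = det{Γ(xᵢ,x̄ⱼ)}`"* (309); *"This identity
can also be used to define `dμ_Γ` when `Γ` is singular"*); J. Dimock, *Ultraviolet stability for QED in d = 3*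
[Dimock2022UVStabilityQED3], §4.2.1 (451) (the unit Gaussian `dμ_I`); J. Dimock, C. Yuan [DimockYuan2024GNFlow] App. B
(475) (`∫ ψ(x)ψ̄(y) dμ_G = G(x,y)`).

**What is proved.**
* **`isChargedCov_twoSpeciesCov`** — `twoSpeciesCov 𝕜 G` pairs the two species only (`IsChargedCov`).
* **`twoPoint_twoSpeciesCov`** — `twoPoint (twoSpeciesCov 𝕜 G) x y = −G y x`: read with the letter NAMES of
  `QED3TwoSpeciesKernels` (`inl` = `Ψ`, `inr` = `Ψ̄`, opposite to `GrassmannIntegral.psiBar = inl`), the bridge's `dμ_G` is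
  the paper's `dμ_Γ` with `Γ = −Gᵀ`; the two conventions name the same letters differently, the measure is one object.
* **`gaussExpect_twoSpeciesCov_pairedProd`** — (309) for `dμ_G`:
  `∫ θ_{inl x₁}θ_{inr y₁}⋯θ_{inl x_n}θ_{inr y_n} dμ_G = det{−G(y_j, x_i)}`;
  **`gaussExpect_twoSpeciesCov_eq_312`** — the expansion (312) of `∫F dμ_G` in the two-species kernels `f_{n,n}`.
* **`twoPoint_twoSpeciesCov_one`** — Dimock's unit Gaussian ((451), `twoSpeciesCov 𝕜 1`): `twoPoint = −[x = y]`, the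
  diagonal charged covariance with coefficient `c = −1` (the shape required by `QED3UnitGaussianMoments`).
* **`unitGaussian_hμ_twoSpeciesCov_one`** — `|∫ θ_S dμ_I| ≤ 1` for Dimock's actual `dμ_I` (the hypothesis `hμ` of
  `QED3LargeFieldFermion.lemma20_step(_printed)` for `μ = ∫·dμ_I`; the step for this `μ` is then one line in
  `QED3LargeFieldFermionIntegration`, which imports this file — not the other way round).
-/

noncomputable section

namespace Literature.MathematicalPhysics.QuantumFieldTheory.Dimock2011to13

namespace QED3TorusI

open Finset Literature.MathematicalPhysics.QuantumLattice Literature.MathematicalPhysics.QuantumLattice.GrassmannAlgebra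

variable {𝕜 : Type*} [RCLike 𝕜] {X : Type*}

/-- **`dμ_G` is charged**: `twoSpeciesCov 𝕜 G` vanishes between letters of the same species (its diagonal blocks are `0`).
[cite: Dimock2002QED3TorusI, App. B (308)–(309) p.63 L35–45] -/
theorem isChargedCov_twoSpeciesCov (G : Matrix X X 𝕜) : IsChargedCov (twoSpeciesCov 𝕜 G) := by
  intro A B hAB
  obtain ⟨a, rfl⟩ := toLex.surjective A
  obtain ⟨b, rfl⟩ := toLex.surjective B
  rcases a with i | i <;> rcases b with j | j
  · exact twoSpeciesCov_inl_inl 𝕜 G i j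
  · simp at hAB
  · simp at hAB
  · exact twoSpeciesCov_inr_inr 𝕜 G i j

/-- **The two-point function of `dμ_G` in the letters of App. B**: `twoPoint (twoSpeciesCov 𝕜 G) x y =
∫ θ_{inl x} θ_{inr y} dμ_G = −G y x` (the bridge's `∫ ψ̄ₓψ_y dμ_G = −G_{yx}`; App. B names the `inl`-letters `Ψ` and the
`inr`-letters `Ψ̄`, so its `Γ(x,ȳ)` for this measure is `−Gᵀ`). [cite: Dimock2002QED3TorusI, App. B (309) p.63 L35–45;
DimockYuan2024GNFlow, App. B (475) p.71] -/
theorem twoPoint_twoSpeciesCov (G : Matrix X X 𝕜) (x y : X) : twoPoint (twoSpeciesCov 𝕜 G) x y = -G y x := by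
  rw [twoPoint, contr_apply, twoSpeciesCov_inr_inl, twoSpeciesCov_inl_inr, ← neg_add', mul_neg,
    half_smul_one_mul_add_self]

variable [LinearOrder X] [Fintype X]

/-- **(309) for `dμ_G`**: `∫ θ_{inl x₁}θ_{inr y₁}⋯θ_{inl x_n}θ_{inr y_n} dμ_G = det{−G(y_j, x_i)}` (`pairedProd`,
`gaussExpect_pairedProd` with `Γ = −Gᵀ`). [cite: Dimock2002QED3TorusI, App. B (309) p.63 L35–45] -/
theorem gaussExpect_twoSpeciesCov_pairedProd (G : Matrix X X 𝕜) {n : ℕ} (x y : Fin n → X) :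
    gaussExpect 𝕜 (twoSpeciesCov 𝕜 G) (pairedProd x y) = (Matrix.of fun i j => -G (y j) (x i)).det := by
  rw [gaussExpect_pairedProd (isChargedCov_twoSpeciesCov G)]
  simp only [twoPoint_twoSpeciesCov]

/-- **(312) for `dμ_G`**: `∫ F dμ_G = Σ_n (σ_n∕(n!)²) Σ_{x,y} f_{n,n}(x, y) det{−G(y_j, x_i)}`, `σ_n = (−1)^{n(n−1)∕2}`.
[cite: Dimock2002QED3TorusI, App. B (312) p.64 L7–18] -/
theorem gaussExpect_twoSpeciesCov_eq_312 (G : Matrix X X 𝕜) (F : GrassmannAlgebra 𝕜 (X ⊕ₗ X)) :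
    gaussExpect 𝕜 (twoSpeciesCov 𝕜 G) F = ∑ n ∈ range (min (Fintype.card X) (Fintype.card X) + 1),
      ((-1 : 𝕜) ^ (n.choose 2) * ((n.factorial : 𝕜)⁻¹ * ((n.factorial : 𝕜)⁻¹))) *
        ∑ x : Fin n → X, ∑ y : Fin n → X, kernel₂ F n n x y * (Matrix.of fun i j => -G (y j) (x i)).det := by
  rw [gaussExpect_eq_312 (isChargedCov_twoSpeciesCov G)]
  simp only [twoPoint_twoSpeciesCov]

omit [Fintype X] in
/-- **Dimock's unit Gaussian `dμ_I`** ((451): `DΨ = e^{⟨Ψ̄,Ψ⟩}dμ_I(Ψ)`, the bridge's `berezin_eq_det_mul_gaussExpect_unit`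
with `twoSpeciesCov 𝕜 1`): its two-point function in the letters of App. B is `−[x = y]` — a charged covariance with
diagonal two-point function of modulus `1` (the shape `c·[x = y]`, `‖c‖ ≤ 1`, under which `QED3UnitGaussianMoments` proves
`|∫θ_S dμ| ≤ 1`). [cite: Dimock2022UVStabilityQED3, §4.2.1 Lemma 20 proof (451) p.61 L30–52] -/
theorem twoPoint_twoSpeciesCov_one (x y : X) :
    twoPoint (twoSpeciesCov 𝕜 (1 : Matrix X X 𝕜)) x y = if x = y then (-1 : 𝕜) else 0 := by
  rw [twoPoint_twoSpeciesCov, Matrix.one_apply]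
  by_cases h : x = y
  · rw [if_pos h, if_pos h.symm]
  · rw [if_neg h, if_neg (Ne.symm h), neg_zero]

/-- The unit covariance's two-point coefficient has modulus `1 ≤ 1`. [cite: Dimock2022UVStabilityQED3, §4.2.1 Lemma 20
proof (451)–(452) p.61 L30–58] -/
theorem norm_neg_one_le_one : ‖(-1 : 𝕜)‖ ≤ 1 := by
  rw [norm_neg, norm_one]

/-! ## `|∫ θ_S dμ_I| ≤ 1` for Dimock's ACTUAL unit Gaussian `dμ_I` (the `hμ` of LEMMA 20's integration step, discharged;
the step itself, `QED3LargeFieldFermion.lemma20_step_printed` with this `μ`, is assembled in that file) -/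

section UnitStep

/-- **`|∫ θ_S dμ_I| ≤ 1` for Dimock's unit Gaussian** `dμ_I = gaussExpect 𝕜 (twoSpeciesCov 𝕜 1)` ((451)): the hypothesis
`hμ` of `QED3LargeFieldFermion.lemma20_step(_printed)` DISCHARGED (`QED3UnitGaussianMoments.unitGaussian_hμ` with
`twoPoint_twoSpeciesCov_one`). [cite: Dimock2022UVStabilityQED3, §4.2.1 Lemma 20 proof (451)–(452) p.61 L30–58] -/
theorem unitGaussian_hμ_twoSpeciesCov_one :
    ∀ T : Finset (X ⊕ₗ X), ‖gaussExpect 𝕜 (twoSpeciesCov 𝕜 (1 : Matrix X X 𝕜)) (grassmannBasis 𝕜 (X ⊕ₗ X) T)‖ ≤ 1 :=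
  unitGaussian_hμ (isChargedCov_twoSpeciesCov 1) norm_neg_one_le_one twoPoint_twoSpeciesCov_one

end UnitStep

end QED3TorusI

end Literature.MathematicalPhysics.QuantumFieldTheory.Dimock2011to13

end
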